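import Mathlib.Algebra.MvPolynomial.Basic
import Mathlib.Algebra.MvPolynomial.Eval
import Mathlib.Data.Finsupp.Interval
import Mathlib.LinearAlgebra.Matrix.Rank
import Mathlib.LinearAlgebra.StdBasis
import Literature.NumberTheory.Transcendental.IntegerTaylor
import HarnessLib

/-!
# Monomial charts, apolarity functionals and Hankel (catalecticant) matrices — definitions

Topic `Literature/Computability/AlgebraicComplexity`. The objects behind the tree's elementary
proof of the cactus barrier for LINEAR RANK METHODS (Buczyński 2026, Thm. 2; Gałązka 2017;
Efremenko–Garg–Oliveira–Wigderson 2018, §3–4), in affine/toric coordinates; the theorems are in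
`HankelRank.lean` (rank of `φ_t` of a product, support splitting) and `ApolarityBound.lean`
(the bound `rk L(t) ≤ k · rk H_t`), the two instantiations in `RankMethodBarriersProofs.lean`
(EGOW Thm. 4.4, cube chart) and `Barriers/MatrixMultiplication/LinearRankMethodBarrierProofs.lean`
(Buczyński's `2(a+b+c−2)`, Segre chart).

* `point α y = (y^{α i})_i ∈ F^I` — the point of the monomial chart with exponents
  `α : I → (σ →₀ ℕ)` at `y ∈ F^σ`; for the Segre variety in an affine chart these are the rank-one
  tensors `w ⊗ u ⊗ v` with one coordinate of each factor equal to `1`, for the cube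
  `(Fⁿ)^{⊗ d}` in homogeneous coordinates all rank-one tensors `u₁ ⊗ ⋯ ⊗ u_d`.
* `phi α t f = Σ_l t_l · coeff_{α l}(f)` — the apolarity functional of a coefficient vector
  `t : I → F` (the local, non-homogeneous apolarity pairing of Bernardi–Ranestad /
  Buczyńska–Buczyński: `t` is the dual generator of a local scheme supported at the origin).
* `downClosure α` — all divisors `β ≤ α i` of the monomials; `coeffExt α t` — `t` extended by zero
  to all exponents; `hankel α t` — the Hankel (catalecticant) matrix `H_t(β, β') = t̃(β + β')` on
  the downward closure, whose rank is the length of the local apolar (Gorenstein) scheme of `φ_t`.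
* `polyMatrix α L` — the matrix of polynomials `M(X) = Σ_i X^{α i} L(e_i)` of a linear map
  `L : F^I → Mat_{p×q}(F)` (a "matrix of linear forms" restricted to the chart): `M(y) = L(χ(y))`
  and `φ_t(M) = L(t)`.
* `shift c` (`f(X) ↦ f(X + c)`) and `genericPhiMatrix α t M` (the polynomial matrix
  `c ↦ φ_t(M(X + c))`, written with the tree's integer Taylor coefficients
  `Literature.NumberTheory.Transcendental.Taylor.taylorCoeff β f = coeff_β f(X + c)` as polynomials
  in `c`, `IntegerTaylor.lean`) — the translation device of Buczyński's Prop. 3.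

References: J. Buczyński, *Cactus barriers*, arXiv:2602.11309, §1.3, Prop. 3, Lemma 5, Thm. 9–10;
A. Bernardi, K. Ranestad, J. Symbolic Comput. 50 (2013) 291–297 (local apolarity, the bound
`2·dim + 2`); EGOW, ITCS 2018 (arXiv:1710.09502), proofs of Thm. 4.2/4.4. The coordinate
formulation is ours; nothing here is attributed to the sources beyond the cited mechanism.
-/

noncomputable section

open scoped BigOperators
open MvPolynomial

namespace Literature.Computability.AlgebraicComplexity

namespace MonomialChart

open Literature.NumberTheory.Transcendental (Taylor.shift Taylor.taylorCoeff)

variable {F : Type*} [Field F]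
variable {σ : Type*} {I : Type*}
variable {p q : Type*}

/-! ## Points of a monomial chart -/

section Point

variable [Fintype σ]

/-- The point `(y^{α i})_{i ∈ I} ∈ F^I` of the monomial chart with exponents `α`, at `y ∈ F^σ`
(`y^β = ∏_v y_v^{β v}`). For the Segre chart these are rank-one tensors. [folklore] -/
def point (α : I → σ →₀ ℕ) (y : σ → F) : I → F :=
  fun i => ∏ v, y v ^ (α i v)

/-- Unfolding lemma. [folklore] -/
theorem point_apply (α : I → σ →₀ ℕ) (y : σ → F) (i : I) :
    point α y i = ∏ v, y v ^ (α i v) := rfl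

/-- `y^{α i}` is the evaluation at `y` of the monomial `X^{α i}`. [folklore] -/
theorem eval_monomial_one_eq_point (α : I → σ →₀ ℕ) (y : σ → F) (i : I) :
    eval y (monomial (α i) (1 : F)) = point α y i := by
  rw [eval_monomial, one_mul, point_apply, Finsupp.prod_fintype]
  intro v; simp

end Point

/-! ## The downward closure of the exponents and the Hankel matrix -/

section Hankel

variable [Fintype I] [DecidableEq σ]

/-- The downward closure `D̄ = {β : β ≤ α i for some i}` of the set of exponents (all divisors of
the monomials `X^{α i}`), a finite set. [folklore] -/
def downClosure (α : I → σ →₀ ℕ) : Finset (σ →₀ ℕ) :=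
  Finset.univ.biUnion fun i => Finset.Icc 0 (α i)

/-- Membership in the downward closure. [folklore] -/
theorem mem_downClosure {α : I → σ →₀ ℕ} {β : σ →₀ ℕ} :
    β ∈ downClosure α ↔ ∃ i, β ≤ α i := by
  simp [downClosure]

/-- The exponents themselves lie in the downward closure. [folklore] -/
theorem self_mem_downClosure (α : I → σ →₀ ℕ) (i : I) : α i ∈ downClosure α :=
  mem_downClosure.2 ⟨i, le_rfl⟩

/-- The extension by zero `t̃` of a coefficient vector `t : I → F` to all exponents:
`t̃(γ) = Σ_{l : α l = γ} t_l` (`= t_l` if `γ = α l` and `α` is injective, `0` off the image).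
[folklore] -/
def coeffExt (α : I → σ →₀ ℕ) (t : I → F) (γ : σ →₀ ℕ) : F :=
  ∑ l, if α l = γ then t l else 0

/-- The **Hankel (catalecticant) matrix** of `t` on the downward closure:
`H_t(β, β') = t̃(β + β')`. Its rank is the length of the local apolar scheme of the functional
`φ_t` (Bernardi–Ranestad; Buczyńska–Buczyński), the quantity bounding what a linear rank method
certifies. [folklore] -/
def hankel (α : I → σ →₀ ℕ) (t : I → F) : Matrix (downClosure α) (downClosure α) F :=
  fun β β' => coeffExt α t (β.1 + β'.1)

/-- Unfolding lemma. [folklore] -/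
theorem hankel_apply (α : I → σ →₀ ℕ) (t : I → F) (β β' : downClosure α) :
    hankel α t β β' = ∑ l, if α l = β.1 + β'.1 then t l else 0 := rfl

/-! ## The apolarity functional `φ_t` -/

/-- The apolarity functional `φ_t(f) = Σ_l t_l · coeff_{α l}(f)` on polynomials. [folklore] -/
def phi (α : I → σ →₀ ℕ) (t : I → F) (f : MvPolynomial σ F) : F :=
  ∑ l, t l * coeff (α l) f

omit [DecidableEq σ] in
/-- `φ_t` is additive over finite sums. [folklore] -/
theorem phi_sum (α : I → σ →₀ ℕ) (t : I → F) {κ : Type*} (s : Finset κ)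
    (f : κ → MvPolynomial σ F) : phi α t (∑ x ∈ s, f x) = ∑ x ∈ s, phi α t (f x) := by
  simp only [phi, coeff_sum, Finset.mul_sum]
  rw [Finset.sum_comm]

omit [DecidableEq σ] in
/-- `φ_t(f - g) = φ_t(f) - φ_t(g)`. [folklore] -/
theorem phi_sub (α : I → σ →₀ ℕ) (t : I → F) (f g : MvPolynomial σ F) :
    phi α t (f - g) = phi α t f - phi α t g := by
  simp only [phi, coeff_sub, mul_sub, Finset.sum_sub_distrib]

omit [DecidableEq σ] in
/-- `φ_t` kills every polynomial none of whose coefficients at the `α l` survive. [folklore] -/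
theorem phi_eq_zero_of_coeff_eq_zero (α : I → σ →₀ ℕ) (t : I → F) {f : MvPolynomial σ F}
    (hf : ∀ l, coeff (α l) f = 0) : phi α t f = 0 := by
  simp [phi, hf]

end Hankel

/-! ## The matrix of polynomials of a linear rank method -/

section PolyMatrix

variable [Fintype I] [DecidableEq I]

/-- The matrix of polynomials `M(X) = Σ_i X^{α i} · L(e_i)` of the linear map `L` on the chart:
its value at `y` is `L(χ(y))`. [folklore] -/
def polyMatrix (α : I → σ →₀ ℕ) (L : (I → F) →ₗ[F] Matrix p q F) :
    Matrix p q (MvPolynomial σ F) :=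
  fun a b => ∑ i, monomial (α i) (L (Pi.single i 1) a b)

/-- Expansion of `L t` in the coordinate basis. [folklore] -/
theorem apply_eq_sum_single (L : (I → F) →ₗ[F] Matrix p q F) (t : I → F)
    (a : p) (b : q) : L t a b = ∑ i, t i * L (Pi.single i 1) a b := by
  conv_lhs => rw [show t = ∑ i, t i • (Pi.single i (1 : F) : I → F) from by
    simpa using ((Pi.basisFun F I).sum_repr t).symm]
  simp [map_sum, map_smul, Matrix.sum_apply]

/-- `M(y) = L(χ(y))`. [folklore] -/
theorem polyMatrix_map_eval [Fintype σ] (α : I → σ →₀ ℕ)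
    (L : (I → F) →ₗ[F] Matrix p q F) (y : σ → F) :
    (polyMatrix α L).map (eval y) = L (point α y) := by
  ext a b
  rw [Matrix.map_apply, apply_eq_sum_single]
  simp only [polyMatrix, map_sum]
  refine Finset.sum_congr rfl fun i _ => ?_
  rw [eval_monomial, mul_comm]
  congr 1
  rw [← eval_monomial_one_eq_point, eval_monomial, one_mul]

/-- `coeff_{α j} M = L(e_j)` (the exponents being distinct). [folklore] -/
theorem coeff_polyMatrix [DecidableEq σ] {α : I → σ →₀ ℕ} (hα : Function.Injective α)
    (L : (I → F) →ₗ[F] Matrix p q F) (j : I) (a : p) (b : q) :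
    coeff (α j) (polyMatrix α L a b) = L (Pi.single j 1) a b := by
  simp only [polyMatrix, coeff_sum, coeff_monomial, hα.eq_iff]
  rw [Finset.sum_ite_eq' Finset.univ j]
  simp

/-- `φ_t(M) = L(t)`: the apolarity functional of `t` recovers `L t` from the matrix of
polynomials. [folklore] -/
theorem map_phi_polyMatrix [DecidableEq σ] {α : I → σ →₀ ℕ} (hα : Function.Injective α)
    (L : (I → F) →ₗ[F] Matrix p q F) (t : I → F) :
    (polyMatrix α L).map (phi α t) = L t := by
  ext a b
  rw [Matrix.map_apply, apply_eq_sum_single]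
  simp only [phi, coeff_polyMatrix hα]

end PolyMatrix

/-! ## Translations -/

section Shift

/-- The translation `f(X) ↦ f(X + c)` by a point `c ∈ F^σ`. [folklore] -/
def shift (c : σ → F) : MvPolynomial σ F →ₐ[F] MvPolynomial σ F :=
  aeval fun v => X v + C (c v)

/-- `f(X + c)` evaluated at `y` is `f(y + c)`. [folklore] -/
theorem eval_shift (c y : σ → F) (f : MvPolynomial σ F) :
    eval y (shift c f) = eval (y + c) f := by
  have h : (eval y).comp (shift c : MvPolynomial σ F →ₐ[F] MvPolynomial σ F).toRingHom =
      eval (y + c) := by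
    refine ringHom_ext (fun a => ?_) (fun v => ?_)
    · simp [shift]
    · simp [shift]
  exact RingHom.congr_fun h f

/-- The constant coefficient of `f(X + c)` is `f(c)`. [folklore] -/
theorem constantCoeff_shift (c : σ → F) (f : MvPolynomial σ F) :
    constantCoeff (shift c f) = eval c f := by
  have h : constantCoeff.comp (shift c : MvPolynomial σ F →ₐ[F] MvPolynomial σ F).toRingHom =
      eval c := by
    refine ringHom_ext (fun a => ?_) (fun v => ?_)
    · simp [shift]
    · simp [shift]
  exact RingHom.congr_fun h f

/-- Translating by `0` does nothing. [folklore] -/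
theorem shift_zero (f : MvPolynomial σ F) : shift (0 : σ → F) f = f := by
  have h : (fun v => X v + C ((0 : σ → F) v)) = (X : σ → MvPolynomial σ F) := by
    funext v; simp
  unfold shift
  rw [h]
  exact aeval_X_left_apply f

/-- Specialising the base point: the tree's generic translation `Taylor.shift f = f(Y + Z)`
(`IntegerTaylor.lean`; coefficients polynomials in the base point `Y`, variables the increment `Z`)
becomes `shift c f = f(X + c)` under `Y ↦ c`. [folklore] -/
theorem map_eval_taylorShift (c : σ → F) (f : MvPolynomial σ F) :
    MvPolynomial.map (eval c) (Taylor.shift f) = shift c f := by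
  have h : (MvPolynomial.map (eval c)).comp
      (Taylor.shift : MvPolynomial σ F →ₐ[F] _).toRingHom =
      (shift c : MvPolynomial σ F →ₐ[F] MvPolynomial σ F).toRingHom := by
    refine ringHom_ext (fun a => ?_) (fun v => ?_)
    · simp [shift]
    · simp [shift, add_comm]
  exact RingHom.congr_fun h f

/-- `coeff_β (f(X + c))` is a polynomial function of `c`, namely the integer Taylor coefficient
`Taylor.taylorCoeff β f` evaluated at `c`. [folklore] -/
theorem eval_taylorCoeff (c : σ → F) (β : σ →₀ ℕ) (f : MvPolynomial σ F) :
    eval c (Taylor.taylorCoeff β f) = coeff β (shift c f) := by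
  rw [Taylor.taylorCoeff, ← map_eval_taylorShift, coeff_map]

end Shift

section Generic

variable [Fintype I]

/-- The polynomial matrix `Ĝ(c) = φ_t(M(X + c))` in the translation parameter `c` (entries
`Σ_l t_l · taylorCoeff_{α l}(M a b)`). [folklore] -/
def genericPhiMatrix (α : I → σ →₀ ℕ) (t : I → F) (M : Matrix p q (MvPolynomial σ F)) :
    Matrix p q (MvPolynomial σ F) :=
  fun a b => ∑ l, C (t l) * Taylor.taylorCoeff (α l) (M a b)

/-- `Ĝ(c) = φ_t(M(X + c))`. [folklore] -/
theorem genericPhiMatrix_map_eval (α : I → σ →₀ ℕ) (t : I → F)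
    (M : Matrix p q (MvPolynomial σ F)) (c : σ → F) :
    (genericPhiMatrix α t M).map (eval c) = (M.map (shift c)).map (phi α t) := by
  ext a b
  simp only [genericPhiMatrix, Matrix.map_apply, map_sum, map_mul, eval_C,
    eval_taylorCoeff, phi]

end Generic

end MonomialChart

end Literature.Computability.AlgebraicComplexity

end
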